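import Mathlib
import HarnessLib

/-!
# Venture HSemireg — the weight selection rule for GENERALIZED weights (non-semisimple torus actions)

HONEST FRAMING. Lean leaf for the computation cell `pub-hsemireg` (target seat t-5 gen 24; files of record
`run/shared/lean/pub/pub-hsemireg/target-g6/KSX-EXACT-t5g23.md` §6 and `REGIME-CENSUS-t5g24.md` §0). In the cell's fibre-test
model an infinitesimal symmetry `D` of a pencil acts on the closed-class space; the WEIGHT SELECTION RULE
(`FibreTestWeightSelectionRule`) says that a trace-like functional vanishes on the cubic form of three EIGEN-classes unless their
weights sum to the critical value. On the record the action of a generic symmetry element need NOT be semisimple (Jordan blocks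
occur: red-3 RED-3 §505, t-5 KSX-EXACT §13.4), so the rule is needed for GENERALIZED eigenvectors. THIS FILE kernel-checks that
extension in an arbitrary (associative, unital) algebra `R` over a commutative ring `k`. The maps `ℓ_a := ad D − a·id`
are taken as opaque functions `f : R → R` with their defining equation `f X = D X − X D − a • X` as a hypothesis
(no new constants are introduced), iterated with `Nat.iterate`:
(1) LEIBNIZ: `ℓ_{a+b}(X Y) = ℓ_a(X)·Y + X·ℓ_b(Y)`;
(2) GENERALIZED WEIGHTS ADD: `ℓ_a^m X = 0` and `ℓ_b^n Y = 0` imply `ℓ_{a+b}^{m+n} (X Y) = 0`, and the three-factor version;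
(3) a `k`-linear functional `τ` that kills every commutator `D M − M D` kills every generalized eigenvector of `ad D` whose
    weight is regular (`IsSMulRegular k a`; over a field: `a ≠ 0`): `ℓ_a^n X = 0 → τ X = 0`;
(4) hence `τ(X Y Z) = 0` for generalized eigenvectors `X, Y, Z` of weights `a, b, c` with `a + b + c` regular — applied to
    the six products of the cubic form `T` (each uses every class once) this is the weight selection rule without any
    diagonalisability hypothesis.
Consequence used by the cell (bookkeeping, not formalised here): every level trace and the supertrace kill `[D,·]` for a
block-diagonal `D`, so `str T(B,B′,B″) = 0` for generalized weight classes off the critical total weight. Nothing here proves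
(W³)₄; nothing here bears on HC, HC_CM or HC_AV.
-/

namespace Summit.Ventures.HSemireg.GeneralizedWeightRule

variable {k R : Type*} [CommRing k] [Ring R] [Algebra k R]

/-- **Leibniz rule for `ad D − (a+b)`:** with `f_a X = DX − XD − a•X` etc., `f_{a+b}(XY) = f_a(X)·Y + X·f_b(Y)`.
[folklore] -/
theorem ell_add_mul (D : R) (a b : k) (fa fb fab : R → R)
    (hfa : ∀ X, fa X = D * X - X * D - a • X) (hfb : ∀ X, fb X = D * X - X * D - b • X)
    (hfab : ∀ X, fab X = D * X - X * D - (a + b) • X) (X Y : R) :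
    fab (X * Y) = fa X * Y + X * fb Y := by
  rw [hfab, hfa, hfb]
  simp only [add_smul, sub_mul, mul_sub, smul_mul_assoc, mul_smul_comm]
  noncomm_ring

/-- `f_a` is additive. -/
theorem ell_map_add (D : R) (a : k) (fa : R → R) (hfa : ∀ X, fa X = D * X - X * D - a • X) (X Y : R) :
    fa (X + Y) = fa X + fa Y := by
  rw [hfa, hfa, hfa]
  simp only [smul_add, mul_add, add_mul]
  abel

/-- `f_a 0 = 0`. -/
theorem ell_map_zero (D : R) (a : k) (fa : R → R) (hfa : ∀ X, fa X = D * X - X * D - a • X) : fa 0 = 0 := by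
  rw [hfa]; simp

/-- Iterates of `f_a` vanish on `0`. -/
theorem ell_iterate_zero (D : R) (a : k) (fa : R → R) (hfa : ∀ X, fa X = D * X - X * D - a • X) (n : ℕ) :
    fa^[n] 0 = 0 := by
  induction n with
  | zero => rfl
  | succ n ih => rw [Function.iterate_succ_apply, ell_map_zero D a fa hfa, ih]

/-- Iterates of `f_a` are additive. -/
theorem ell_iterate_add (D : R) (a : k) (fa : R → R) (hfa : ∀ X, fa X = D * X - X * D - a • X) (n : ℕ) (X Y : R) :
    fa^[n] (X + Y) = fa^[n] X + fa^[n] Y := by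
  induction n generalizing X Y with
  | zero => rfl
  | succ n ih => rw [Function.iterate_succ_apply, Function.iterate_succ_apply, Function.iterate_succ_apply,
      ell_map_add D a fa hfa, ih]

/-- **Generalized weights add (two factors).** If `f_a^m X = 0` and `f_b^n Y = 0` then `f_{a+b}^{m+n}(XY) = 0`.
[folklore: generalized eigenspaces of a derivation multiply] -/
theorem ell_iterate_mul_eq_zero (D : R) (a b : k) (fa fb fab : R → R)
    (hfa : ∀ X, fa X = D * X - X * D - a • X) (hfb : ∀ X, fb X = D * X - X * D - b • X)
    (hfab : ∀ X, fab X = D * X - X * D - (a + b) • X) :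
    ∀ (s m n : ℕ) (X Y : R), m + n = s → fa^[m] X = 0 → fb^[n] Y = 0 → fab^[m + n] (X * Y) = 0 := by
  intro s
  induction s with
  | zero =>
    intro m n X Y hs hX _
    have hm : m = 0 := by omega
    subst hm
    simp only [Function.iterate_zero, id_eq] at hX
    rw [hX, zero_mul, ell_iterate_zero D (a + b) fab hfab]
  | succ s ih =>
    intro m n X Y hs hX hY
    cases m with
    | zero =>
      simp only [Function.iterate_zero, id_eq] at hX
      rw [hX, zero_mul, ell_iterate_zero D (a + b) fab hfab]
    | succ m =>
      cases n with
      | zero =>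
        simp only [Function.iterate_zero, id_eq] at hY
        rw [hY, mul_zero, ell_iterate_zero D (a + b) fab hfab]
      | succ n =>
        have hstep : fab^[m + 1 + (n + 1)] (X * Y)
            = fab^[m + n + 1] (fa X * Y) + fab^[m + n + 1] (X * fb Y) := by
          have : m + 1 + (n + 1) = (m + n + 1) + 1 := by omega
          rw [this, Function.iterate_succ_apply, ell_add_mul D a b fa fb fab hfa hfb hfab,
            ell_iterate_add D (a + b) fab hfab]
        have hX' : fa^[m] (fa X) = 0 := by
          rw [← Function.iterate_succ_apply]; exact hX
        have hY' : fb^[n] (fb Y) = 0 := by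
          rw [← Function.iterate_succ_apply]; exact hY
        have h1 : fab^[m + (n + 1)] (fa X * Y) = 0 := ih m (n + 1) (fa X) Y (by omega) hX' hY
        have h2 : fab^[(m + 1) + n] (X * fb Y) = 0 := ih (m + 1) n X (fb Y) (by omega) hX hY'
        have e1 : m + (n + 1) = m + n + 1 := by omega
        have e2 : (m + 1) + n = m + n + 1 := by omega
        rw [e1] at h1
        rw [e2] at h2
        rw [hstep, h1, h2, add_zero]

/-- **Generalized weights add (three factors).** `f_a^m X = 0`, `f_b^n Y = 0`, `f_c^p Z = 0` imply
`f_{a+b+c}^{m+n+p}(XYZ) = 0`. -/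
theorem ell_iterate_mul_three_eq_zero (D : R) (a b c : k) (fa fb fc fab fabc : R → R)
    (hfa : ∀ X, fa X = D * X - X * D - a • X) (hfb : ∀ X, fb X = D * X - X * D - b • X)
    (hfc : ∀ X, fc X = D * X - X * D - c • X) (hfab : ∀ X, fab X = D * X - X * D - (a + b) • X)
    (hfabc : ∀ X, fabc X = D * X - X * D - (a + b + c) • X)
    (m n p : ℕ) (X Y Z : R) (hX : fa^[m] X = 0) (hY : fb^[n] Y = 0) (hZ : fc^[p] Z = 0) :
    fabc^[m + n + p] (X * Y * Z) = 0 :=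
  ell_iterate_mul_eq_zero D (a + b) c fab fc fabc hfab hfc hfabc (m + n + p) (m + n) p (X * Y) Z rfl
    (ell_iterate_mul_eq_zero D a b fa fb fab hfa hfb hfab (m + n) m n X Y rfl hX hY) hZ

/-- **A functional that kills `ad D`-commutators kills every generalized eigenvector of regular weight.** If `τ` is
`k`-linear with `τ(DM − MD) = 0` for all `M`, `f_a^n X = 0`, and `a` is regular for the scalar action on `k`, then `τ X = 0`.
[folklore] -/
theorem functional_eq_zero_of_generalized_weight (D : R) (τ : R →ₗ[k] k) (hτ : ∀ M : R, τ (D * M - M * D) = 0)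
    (a : k) (ha : IsSMulRegular k a) (fa : R → R) (hfa : ∀ X, fa X = D * X - X * D - a • X) :
    ∀ (n : ℕ) (X : R), fa^[n] X = 0 → τ X = 0 := by
  intro n
  induction n with
  | zero =>
    intro X hX
    simp only [Function.iterate_zero, id_eq] at hX
    simp [hX]
  | succ n ih =>
    intro X hX
    rw [Function.iterate_succ_apply] at hX
    have h1 : τ (fa X) = 0 := ih _ hX
    rw [hfa, map_sub, hτ X, zero_sub, neg_eq_zero, map_smul] at h1
    exact ha (by simpa using h1)

/-- Field version: `a ≠ 0 → f_a^n X = 0 → τ X = 0`. -/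
theorem functional_eq_zero_of_generalized_weight_ne_zero {K S : Type*} [Field K] [Ring S] [Algebra K S]
    (D : S) (τ : S →ₗ[K] K) (hτ : ∀ M : S, τ (D * M - M * D) = 0) (a : K) (ha : a ≠ 0)
    (fa : S → S) (hfa : ∀ X, fa X = D * X - X * D - a • X) (n : ℕ) (X : S) (hX : fa^[n] X = 0) : τ X = 0 :=
  functional_eq_zero_of_generalized_weight D τ hτ a (IsRegular.of_ne_zero ha).left.isSMulRegular fa hfa n X hX

/-- **Generalized weight selection rule (the form the cell uses).** Three generalized eigenvectors of `ad D` with weights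
`a, b, c` and a commutator-killing functional `τ`: if `a + b + c` is regular then `τ(XYZ) = 0`. Applied to the six
products of the cubic form `T` (each uses every class once) this gives `τ(T) = 0` off the critical total weight. -/
theorem functional_mul_three_eq_zero (D : R) (τ : R →ₗ[k] k) (hτ : ∀ M : R, τ (D * M - M * D) = 0)
    (a b c : k) (habc : IsSMulRegular k (a + b + c)) (fa fb fc fab fabc : R → R)
    (hfa : ∀ X, fa X = D * X - X * D - a • X) (hfb : ∀ X, fb X = D * X - X * D - b • X)
    (hfc : ∀ X, fc X = D * X - X * D - c • X) (hfab : ∀ X, fab X = D * X - X * D - (a + b) • X)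
    (hfabc : ∀ X, fabc X = D * X - X * D - (a + b + c) • X)
    (m n p : ℕ) (X Y Z : R) (hX : fa^[m] X = 0) (hY : fb^[n] Y = 0) (hZ : fc^[p] Z = 0) :
    τ (X * Y * Z) = 0 :=
  functional_eq_zero_of_generalized_weight D τ hτ (a + b + c) habc fabc hfabc (m + n + p) (X * Y * Z)
    (ell_iterate_mul_three_eq_zero D a b c fa fb fc fab fabc hfa hfb hfc hfab hfabc m n p X Y Z hX hY hZ)

/-- **Cubic form.** The weight selection rule for generalized weights, stated for the cell's cubic form
`T(B,C,E) = B₁C₂E₃ + B₂C₃E₁ + B₃C₁E₂ − B₁C₃E₂ − B₃C₂E₁ − B₂C₁E₃` of three generalized weight classes with weights `a,b,c`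
(all three components of a class in the same generalized eigenspace, as for weight classes of the torus action):
if `a + b + c` is regular then `τ(T) = 0`. -/
theorem functional_T6_eq_zero (D : R) (τ : R →ₗ[k] k) (hτ : ∀ M : R, τ (D * M - M * D) = 0)
    (a b c : k) (habc : IsSMulRegular k (a + b + c)) (fa fb fc fab fabc : R → R)
    (hfa : ∀ X, fa X = D * X - X * D - a • X) (hfb : ∀ X, fb X = D * X - X * D - b • X)
    (hfc : ∀ X, fc X = D * X - X * D - c • X) (hfab : ∀ X, fab X = D * X - X * D - (a + b) • X)
    (hfabc : ∀ X, fabc X = D * X - X * D - (a + b + c) • X)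
    (N : ℕ) (B1 B2 B3 C1 C2 C3 E1 E2 E3 : R)
    (hB1 : fa^[N] B1 = 0) (hB2 : fa^[N] B2 = 0) (hB3 : fa^[N] B3 = 0)
    (hC1 : fb^[N] C1 = 0) (hC2 : fb^[N] C2 = 0) (hC3 : fb^[N] C3 = 0)
    (hE1 : fc^[N] E1 = 0) (hE2 : fc^[N] E2 = 0) (hE3 : fc^[N] E3 = 0) :
    τ (B1 * C2 * E3 + B2 * C3 * E1 + B3 * C1 * E2 - B1 * C3 * E2 - B3 * C2 * E1 - B2 * C1 * E3) = 0 := by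
  have h := fun (X Y Z : R) (hX : fa^[N] X = 0) (hY : fb^[N] Y = 0) (hZ : fc^[N] Z = 0) =>
    functional_mul_three_eq_zero D τ hτ a b c habc fa fb fc fab fabc hfa hfb hfc hfab hfabc N N N X Y Z hX hY hZ
  simp only [map_add, map_sub, h B1 C2 E3 hB1 hC2 hE3, h B2 C3 E1 hB2 hC3 hE1, h B3 C1 E2 hB3 hC1 hE2,
    h B1 C3 E2 hB1 hC3 hE2, h B3 C2 E1 hB3 hC2 hE1, h B2 C1 E3 hB2 hC1 hE3, add_zero, sub_zero]

end Summit.Ventures.HSemireg.GeneralizedWeightRule
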